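import Summits.AtomisticToContinuum.HydrodynamicLimit.Theorems.AntiMazurCoboundariesCorrectorPressureDecayKiferGibbsMixtureWallCore

/-!
# The Gibbs-mixture wall, core II: the Gaussian second-order lemma
# (line `FirstLemma`, crux stmt-AtomisticToContinuum-14135 `AntiMazurCoboundaries.CorrectorPressureDecay`; lead seat c9)

Second helper file of the registered stub `gibbsMixtureWall_holds : GibbsMixtureWall` (…KiferWallMacroErgodic.lean),
namespace `Summit.AtomisticToContinuum.HydrodynamicLimit.Theorems.KiferCompactification`: piece (P2) of the lead's design,
the GAUSSIAN SECOND-ORDER LEMMA, which converts the orthogonality clause `g ⊥ 1, v, |v|²` of the wall into smallness of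
the one-body bias of a Maxwellian with the wrong parameters, measured by its entropy:

* `c9_gaussian_orthogonal_mean_le_kl` (MAIN, registered): there is a universal `C > 0` (here `400/3`) such that for every
  continuous `g : ℝ³ → ℝ` with `|g| ≤ 1` and `∫ g (c₀ + ⟨b,v⟩ + c₂|v|²) dN(0,I) = 0` for all `c₀, c₂, b`, every `a ∈ ℝ³`
  and `r > 0`: `|∫ g(a + √r w) dN(0,I)(w)| ≤ C (|a|² + 3(r - 1 - log r))/2`, i.e.
  `|E_{N(a,rI)} g| ≤ C · KL(N(a, rI) ‖ N(0, I))`; `c9_gaussian_orthogonal_mean_le_kl_of_bound` is the scaled form for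
  `|g| ≤ K`.
* Mechanism (`gmw_abs_integral_affine_le_near`, the regime `|a|² ≤ 1/8`, `|r-1| ≤ 1/8`): with `ψ = ψ_{a,r}` the density
  of `N(a, rI)`, `φ` that of `N(0, I)`, `L = ψ/φ` (the likelihood ratio) and `T = 1 + ⟨a,w⟩ + ((r-1)/2)(|w|² - 3)`
  (its first-order Taylor polynomial at `(0, 1)`, an element of `span{1, wᵢ, |w|²}`): `E_{N(a,rI)} g = ∫ g ψ = ∫ g (ψ - φT)` (orthogonality), so
  `|E g| ≤ ∫ |ψ - φT| = ∫ |L - T| dN(0,I) ≤ (∫ (L-T)² dN(0,I))^{1/2}` (Jensen), and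
  `∫ (L-T)² = ∫L² - 2∫LT + ∫T² = (r(2-r))^{-3/2}e^{|a|²/(2-r)} - 2 E_{N(a,rI)}T + E_{N(0,I)}T²` is explicit
  (`gmw_integral_likelihoodRatio_sq`, `gmw_integral_likelihoodRatio_mul_taylorPoly`, `gmw_integral_taylorPoly_sq`, from
  core I) and `≤ 25 KL²` by `c9_gaussian_remainder_le_sq_entropy`. Far from `(0,1)`, `|E g| ≤ 1` while
  `KL ≥ 3/400` (`gmw_sub_one_sub_log_ge_of_far`).
-/

noncomputable section

open MeasureTheory ProbabilityTheory Real Filter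
open scoped ENNReal NNReal InnerProductSpace

namespace Summit.AtomisticToContinuum.HydrodynamicLimit.Theorems.KiferCompactification

open Literature.MathematicalPhysics.KineticTheory (V3 integral_localMaxwellian_smul integrable_localMaxwellian
  integrable_norm_sq_stdGaussian integral_norm_sq_stdGaussian continuous_localMaxwellian)
open Literature.Analysis.FluidPDE (globalMaxwellian localMaxwellian globalMaxwellian_pos continuous_globalMaxwellian)

/-! ## The likelihood ratio and its first-order Taylor polynomial -/

/-! Below `T_{a,r}(w) = 1 + ⟨a, w⟩ + ((r-1)/2)(|w|² - 3)` is the first-order Taylor polynomial at `(a, r) = (0, 1)` of the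
likelihood ratio `L_{a,r}(w) = dN(a, rI)/dN(0, I)(w) = ψ_{a,r}(w)/φ(w)`; both are written out in the statements. -/

/-- `T_{a,r} ∈ L²(N(0, I))`. -/
theorem gmw_memLp_two_taylorPoly (a : V3) (r : ℝ) :
    MemLp (fun w : V3 => 1 + ⟪a, w⟫_ℝ + (r - 1) / 2 * (‖w‖ ^ 2 - 3)) 2 (stdGaussian V3) := by
  have h := ((memLp_const (1 : ℝ)).add (gmw_memLp_inner_stdGaussian a 2 (by simp))).add
    ((gmw_memLp_two_norm_sq_stdGaussian.sub (memLp_const (3 : ℝ))).const_mul ((r - 1) / 2) (μ := stdGaussian V3))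
  refine h.ae_eq (Eventually.of_forall fun w => ?_)
  simp only [Pi.add_apply, Pi.sub_apply]

/-- `L_{a,r}` is continuous. -/
theorem gmw_continuous_likelihoodRatio (a : V3) (r : ℝ) : Continuous (fun w : V3 => localMaxwellian 1 r a w / globalMaxwellian w) :=
  (continuous_localMaxwellian 1 r a).div continuous_globalMaxwellian fun v => (globalMaxwellian_pos v).ne'

/-- `L_{a,r} ∈ L²(N(0, I))` for `0 < r < 2` (its square integrates to the chi-square integral). -/
theorem gmw_memLp_two_likelihoodRatio {r : ℝ} (hr : 0 < r) (hr2 : r < 2) (a : V3) :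
    MemLp (fun w : V3 => localMaxwellian 1 r a w / globalMaxwellian w) 2 (stdGaussian V3) := by
  rw [memLp_two_iff_integrable_sq (gmw_continuous_likelihoodRatio a r).aestronglyMeasurable, gmw_integrable_stdGaussian_iff]
  have hs : 0 < 1 / r - 1 / 2 := by
    rw [sub_pos, one_div_lt_one_div two_pos hr]
    exact hr2
  refine (((gmw_integrable_rexp_neg_mul_sq_norm hs).comp_sub_right ((2 / (2 - r)) • a)).const_mul
    (((2 * π * r) ^ (-(3 : ℝ) / 2)) ^ 2 / (2 * π) ^ (-(3 : ℝ) / 2) * rexp (‖a‖ ^ 2 / (2 - r)))).congr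
    (Eventually.of_forall fun v => ?_)
  dsimp only
  rw [← gmw_localMaxwellian_sq_div_globalMaxwellian hr hr2 a v]
  field_simp [(globalMaxwellian_pos v).ne']

/-- `∫ L_{a,r}² dN(0,I) = (r(2-r))^{-3/2} e^{|a|²/(2-r)}`. -/
theorem gmw_integral_likelihoodRatio_sq {r : ℝ} (hr : 0 < r) (hr2 : r < 2) (a : V3) :
    ∫ w, (localMaxwellian 1 r a w / globalMaxwellian w) ^ 2 ∂stdGaussian V3 =
      (r * (2 - r)) ^ (-(3 : ℝ) / 2) * rexp (‖a‖ ^ 2 / (2 - r)) := by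
  rw [gmw_integral_stdGaussian_eq_integral_mul, ← gmw_integral_localMaxwellian_sq_div hr hr2 a]
  refine integral_congr_ae (Eventually.of_forall fun v => ?_)
  field_simp [(globalMaxwellian_pos v).ne']

/-- `∫ T_{a,r}(a + √r w) dN(0,I)(w) = E_{N(a,rI)} T_{a,r} = 1 + |a|² + ((r-1)/2)(|a|² + 3(r-1))`. -/
theorem gmw_integral_taylorPoly_affine {r : ℝ} (hr : 0 < r) (a : V3) :
    ∫ w, (1 + ⟪a, a + Real.sqrt r • w⟫_ℝ + (r - 1) / 2 * (‖a + Real.sqrt r • w‖ ^ 2 - 3)) ∂stdGaussian V3 =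
      1 + ‖a‖ ^ 2 + (r - 1) / 2 * (‖a‖ ^ 2 + 3 * (r - 1)) := by
  have hpt : ∀ w : V3, (1 + ⟪a, a + Real.sqrt r • w⟫_ℝ + (r - 1) / 2 * (‖a + Real.sqrt r • w‖ ^ 2 - 3)) =
      (1 + ‖a‖ ^ 2 + (r - 1) / 2 * (‖a‖ ^ 2 - 3)) +
      (Real.sqrt r * (1 + (r - 1))) * ⟪a, w⟫_ℝ + ((r - 1) / 2 * r) * ‖w‖ ^ 2 := by
    intro w
    simp only [inner_add_right, inner_smul_right, norm_add_sq_real, norm_smul, mul_pow,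
      real_inner_self_eq_norm_sq, Real.norm_eq_abs, sq_abs, Real.sq_sqrt hr.le]
    ring
  simp_rw [hpt]
  have h1 : Integrable (fun w : V3 => Real.sqrt r * (1 + (r - 1)) * ⟪a, w⟫_ℝ) (stdGaussian V3) :=
    ((gmw_memLp_inner_stdGaussian a 2 (by simp)).integrable one_le_two).const_mul _
  have h2 : Integrable (fun w : V3 => (r - 1) / 2 * r * ‖w‖ ^ 2) (stdGaussian V3) :=
    (integrable_norm_sq_stdGaussian (ι := Fin 3)).const_mul _
  have h01 : Integrable (fun w : V3 => 1 + ‖a‖ ^ 2 + (r - 1) / 2 * (‖a‖ ^ 2 - 3) + Real.sqrt r * (1 + (r - 1)) * ⟪a, w⟫_ℝ)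
      (stdGaussian V3) := (integrable_const _).add h1
  rw [integral_add h01 h2, integral_add (integrable_const _) h1, integral_const,
    integral_const_mul, integral_const_mul, gmw_integral_inner_stdGaussian, probReal_univ,
    show stdGaussian V3 = stdGaussian (EuclideanSpace ℝ (Fin 3)) from rfl, integral_norm_sq_stdGaussian]
  simp only [smul_eq_mul, one_mul, mul_zero, add_zero, Fintype.card_fin, Nat.cast_ofNat]
  ring

/-- `∫ T_{a,r}² dN(0,I) = 1 + |a|² + 3(r-1)²/2` (orthogonality of `1, ⟨a,w⟩, |w|² - 3`, `E⟨a,w⟩² = |a|²`,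
`E(|w|² - 3)² = 6`, and the vanishing of the odd moment `E ⟨a,w⟩(|w|² - 3)`). -/
theorem gmw_integral_taylorPoly_sq (a : V3) (r : ℝ) :
    ∫ w, (1 + ⟪a, w⟫_ℝ + (r - 1) / 2 * (‖w‖ ^ 2 - 3)) ^ 2 ∂stdGaussian V3 = 1 + ‖a‖ ^ 2 + 3 * (r - 1) ^ 2 / 2 := by
  have hpt : ∀ w : V3, (1 + ⟪a, w⟫_ℝ + (r - 1) / 2 * (‖w‖ ^ 2 - 3)) ^ 2 = 1 + ⟪a, w⟫_ℝ ^ 2 + ((r - 1) / 2) ^ 2 * (‖w‖ ^ 2 - 3) ^ 2 + 2 * ⟪a, w⟫_ℝ +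
      2 * ((r - 1) / 2) * (‖w‖ ^ 2 - 3) + 2 * ((r - 1) / 2) * (⟪a, w⟫_ℝ * (‖w‖ ^ 2 - 3)) := by
    intro w
    ring
  simp_rw [hpt]
  have hA : MemLp (fun w : V3 => ⟪a, w⟫_ℝ) 2 (stdGaussian V3) := gmw_memLp_inner_stdGaussian a 2 (by simp)
  have hS : MemLp (fun w : V3 => ‖w‖ ^ 2 - 3) 2 (stdGaussian V3) := gmw_memLp_two_norm_sq_stdGaussian.sub (memLp_const 3)
  have h1 : Integrable (fun w : V3 => ⟪a, w⟫_ℝ ^ 2) (stdGaussian V3) := hA.integrable_sq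
  have h2 : Integrable (fun w : V3 => ((r - 1) / 2) ^ 2 * (‖w‖ ^ 2 - 3) ^ 2) (stdGaussian V3) := hS.integrable_sq.const_mul _
  have h3 : Integrable (fun w : V3 => 2 * ⟪a, w⟫_ℝ) (stdGaussian V3) := (hA.integrable one_le_two).const_mul _
  have h4 : Integrable (fun w : V3 => 2 * ((r - 1) / 2) * (‖w‖ ^ 2 - 3)) (stdGaussian V3) := (hS.integrable one_le_two).const_mul _
  have h5 : Integrable (fun w : V3 => 2 * ((r - 1) / 2) * (⟪a, w⟫_ℝ * (‖w‖ ^ 2 - 3))) (stdGaussian V3) :=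
    (hA.integrable_mul hS).const_mul _
  -- the odd moment `E ⟨a,w⟩(|w|² - 3)` vanishes by the symmetry `w ↦ -w` of `N(0, I)` (no integrability needed)
  have hodd : ∫ w : V3, ⟪a, w⟫_ℝ * (‖w‖ ^ 2 - 3) ∂stdGaussian V3 = 0 := by
    have hmap : (stdGaussian V3).map (MeasurableEquiv.neg V3) = stdGaussian V3 :=
      stdGaussian_map (LinearIsometryEquiv.neg ℝ (E := V3))
    have h : ∫ w : V3, ⟪a, w⟫_ℝ * (‖w‖ ^ 2 - 3) ∂stdGaussian V3 = ∫ w : V3, -(⟪a, w⟫_ℝ * (‖w‖ ^ 2 - 3)) ∂stdGaussian V3 := by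
      conv_lhs => rw [← hmap, integral_map_equiv]
      exact integral_congr_ae (Eventually.of_forall fun w => by simp [inner_neg_right, norm_neg])
    rw [integral_neg] at h
    linarith
  have hS0 : ∫ w : V3, (‖w‖ ^ 2 - 3) ∂stdGaussian V3 = 0 := by
    rw [integral_sub (integrable_norm_sq_stdGaussian (ι := Fin 3)) (integrable_const _), integral_const,
      show stdGaussian V3 = stdGaussian (EuclideanSpace ℝ (Fin 3)) from rfl, integral_norm_sq_stdGaussian]
    simp
  have h12 : Integrable (fun w : V3 => 1 + ⟪a, w⟫_ℝ ^ 2) (stdGaussian V3) := (integrable_const _).add h1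
  have h123 : Integrable (fun w : V3 => 1 + ⟪a, w⟫_ℝ ^ 2 + ((r - 1) / 2) ^ 2 * (‖w‖ ^ 2 - 3) ^ 2) (stdGaussian V3) := h12.add h2
  have h1234 : Integrable (fun w : V3 => 1 + ⟪a, w⟫_ℝ ^ 2 + ((r - 1) / 2) ^ 2 * (‖w‖ ^ 2 - 3) ^ 2 + 2 * ⟪a, w⟫_ℝ) (stdGaussian V3) :=
    h123.add h3
  have h12345 : Integrable (fun w : V3 => 1 + ⟪a, w⟫_ℝ ^ 2 + ((r - 1) / 2) ^ 2 * (‖w‖ ^ 2 - 3) ^ 2 + 2 * ⟪a, w⟫_ℝ +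
      2 * ((r - 1) / 2) * (‖w‖ ^ 2 - 3)) (stdGaussian V3) := h1234.add h4
  rw [integral_add h12345 h5, integral_add h1234 h4, integral_add h123 h3, integral_add h12 h2,
    integral_add (integrable_const _) h1, integral_const,
    integral_const_mul, integral_const_mul, integral_const_mul, integral_const_mul, gmw_integral_inner_sq_stdGaussian,
    gmw_integral_norm_sq_sub_three_sq_stdGaussian, gmw_integral_inner_stdGaussian, hS0, hodd]
  simp only [probReal_univ, smul_eq_mul, one_mul, mul_zero, add_zero]
  ring

/-- `∫ L_{a,r} T_{a,r} dN(0,I) = E_{N(a,rI)} T_{a,r}`. -/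
theorem gmw_integral_likelihoodRatio_mul_taylorPoly {r : ℝ} (hr : 0 < r) (a : V3) :
    ∫ w, (localMaxwellian 1 r a w / globalMaxwellian w) * (1 + ⟪a, w⟫_ℝ + (r - 1) / 2 * (‖w‖ ^ 2 - 3)) ∂stdGaussian V3 =
      1 + ‖a‖ ^ 2 + (r - 1) / 2 * (‖a‖ ^ 2 + 3 * (r - 1)) := by
  rw [gmw_integral_stdGaussian_eq_integral_mul, ← gmw_integral_taylorPoly_affine hr a,
    ← integral_localMaxwellian_smul hr a (fun v : V3 => 1 + ⟪a, v⟫_ℝ + (r - 1) / 2 * (‖v‖ ^ 2 - 3))]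
  refine integral_congr_ae (Eventually.of_forall fun v => ?_)
  simp only [smul_eq_mul]
  field_simp [(globalMaxwellian_pos v).ne']

/-! ## The near regime -/

/-- **Near `(0, 1)` the mean of an orthogonal test function is of second order.** For continuous `|g| ≤ 1` orthogonal
to `1, v, |v|²` in `L²(N(0,I))`, `|a|² ≤ 1/8` and `|r - 1| ≤ 1/8`: `|E_{N(a,rI)} g| ≤ 5 D(a,r)` with
`D(a,r) = (|a|² + 3(r - 1 - log r))/2 = KL(N(a,rI) ‖ N(0,I))`. Mechanism: `E_{N(a,rI)} g = ∫ g (ψ_{a,r} - φ T_{a,r})`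
by orthogonality, `≤ ∫ |L_{a,r} - T_{a,r}| dN(0,I) ≤ (∫ (L - T)² dN(0,I))^{1/2}`, and the last integral is the explicit
remainder bounded by `25 D²`. -/
theorem gmw_abs_integral_affine_le_near {g : V3 → ℝ} (hg : Continuous g) (hg1 : ∀ v, |g v| ≤ 1)
    (horth : ∀ (c₀ c₂ : ℝ) (b : V3), ∫ v, g v * (c₀ + inner ℝ b v + c₂ * ‖v‖ ^ 2) ∂(stdGaussian V3) = 0)
    {a : V3} {r : ℝ} (hr : 0 < r) (ht : ‖a‖ ^ 2 ≤ 1 / 8) (hu : |r - 1| ≤ 1 / 8) :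
    |∫ w, g (a + Real.sqrt r • w) ∂stdGaussian V3| ≤ 5 * ((‖a‖ ^ 2 + 3 * (r - 1 - Real.log r)) / 2) := by
  have hr2 : r < 2 := by linarith [(abs_le.1 hu).2]
  set ψ : V3 → ℝ := localMaxwellian 1 r a with hψ
  set φ : V3 → ℝ := globalMaxwellian with hφ
  set T : V3 → ℝ := (fun w : V3 => 1 + ⟪a, w⟫_ℝ + (r - 1) / 2 * (‖w‖ ^ 2 - 3)) with hT
  set L : V3 → ℝ := (fun w : V3 => localMaxwellian 1 r a w / globalMaxwellian w) with hL
  have hφpos : ∀ v, 0 < φ v := globalMaxwellian_pos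
  have hgm : AEStronglyMeasurable g (volume : Measure V3) := hg.aestronglyMeasurable
  have hg1' : ∀ᵐ v ∂(volume : Measure V3), ‖g v‖ ≤ 1 := ae_of_all _ fun v => by rw [Real.norm_eq_abs]; exact hg1 v
  -- the mean as a Lebesgue integral against `ψ`
  have hE : ∫ w, g (a + Real.sqrt r • w) ∂stdGaussian V3 = ∫ v, g v * ψ v := by
    rw [← integral_localMaxwellian_smul hr a g]
    refine integral_congr_ae (Eventually.of_forall fun v => ?_)
    simp only [smul_eq_mul, hψ]
    ring
  -- orthogonality in Lebesgue form: `∫ g φ T = 0`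
  have hTint : Integrable T (stdGaussian V3) := (gmw_memLp_two_taylorPoly a r).integrable one_le_two
  have horth' : ∫ v, g v * (φ v * T v) = 0 := by
    have h := horth (1 - 3 * (r - 1) / 2) ((r - 1) / 2) a
    rw [gmw_integral_stdGaussian_eq_integral_mul] at h
    rw [← h]
    refine integral_congr_ae (Eventually.of_forall fun v => ?_)
    simp only [hT, hφ]
    ring
  have hψg : Integrable (fun v => g v * ψ v) := (integrable_localMaxwellian hr a).bdd_mul hgm hg1'
  have hφT : Integrable (fun v => φ v * T v) := (gmw_integrable_stdGaussian_iff T).1 hTint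
  have hφTg : Integrable (fun v => g v * (φ v * T v)) := hφT.bdd_mul hgm hg1'
  -- `E = ∫ g (ψ - φ T)` and `|E| ≤ ∫ |ψ - φ T| = ∫ |L - T| dN(0,I)`
  have hE2 : ∫ w, g (a + Real.sqrt r • w) ∂stdGaussian V3 = ∫ v, g v * (ψ v - φ v * T v) := by
    rw [hE, ← sub_zero (∫ v, g v * ψ v), ← horth', ← integral_sub hψg hφTg]
    refine integral_congr_ae (Eventually.of_forall fun v => ?_)
    ring
  have hW : Integrable (fun v => ψ v - φ v * T v) := (integrable_localMaxwellian hr a).sub hφT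
  have h3 : |∫ w, g (a + Real.sqrt r • w) ∂stdGaussian V3| ≤ ∫ v, |ψ v - φ v * T v| := by
    rw [hE2, ← Real.norm_eq_abs]
    refine norm_integral_le_of_norm_le hW.abs (ae_of_all _ fun v => ?_)
    rw [Real.norm_eq_abs, abs_mul]
    exact mul_le_of_le_one_left (abs_nonneg _) (hg1 v)
  have h4 : ∫ v, |ψ v - φ v * T v| = ∫ w, |L w - T w| ∂stdGaussian V3 := by
    rw [gmw_integral_stdGaussian_eq_integral_mul]
    refine integral_congr_ae (Eventually.of_forall fun v => ?_)
    have hφv := hφpos v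
    have hid : φ v * L v = ψ v := by
      simp only [hL, hφ, hψ]
      field_simp [(globalMaxwellian_pos v).ne']
    show |ψ v - φ v * T v| = φ v * |L v - T v|
    calc |ψ v - φ v * T v| = |φ v * (L v - T v)| := by rw [mul_sub, hid]
      _ = φ v * |L v - T v| := by rw [abs_mul, abs_of_pos hφv]
  -- Jensen: `(∫ |L - T|)² ≤ ∫ (L - T)²`, and the value of the latter
  have hLm := gmw_memLp_two_likelihoodRatio hr hr2 a
  have hTm := gmw_memLp_two_taylorPoly a r
  have hLTabs : MemLp (fun w => |L w - T w|) 2 (stdGaussian V3) := (hLm.sub hTm).abs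
  have h5 : (∫ w, |L w - T w| ∂stdGaussian V3) ^ 2 ≤ ∫ w, (L w - T w) ^ 2 ∂stdGaussian V3 := by
    have hv := variance_nonneg (fun w => |L w - T w|) (stdGaussian V3)
    rw [variance_eq_sub hLTabs] at hv
    simp only [Pi.pow_apply, sq_abs] at hv
    linarith
  have hL2 : Integrable (fun w => L w ^ 2) (stdGaussian V3) := hLm.integrable_sq
  have hLT2 : Integrable (fun w => 2 * (L w * T w)) (stdGaussian V3) := (hLm.integrable_mul hTm).const_mul 2
  have hT2 : Integrable (fun w => T w ^ 2) (stdGaussian V3) := hTm.integrable_sq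
  have h6 : ∫ w, (L w - T w) ^ 2 ∂stdGaussian V3 = (r * (2 - r)) ^ (-(3 : ℝ) / 2) * rexp (‖a‖ ^ 2 / (2 - r)) -
      2 * (1 + ‖a‖ ^ 2 + (r - 1) / 2 * (‖a‖ ^ 2 + 3 * (r - 1))) + (1 + ‖a‖ ^ 2 + 3 * (r - 1) ^ 2 / 2) := by
    have hL2T : Integrable (fun w => L w ^ 2 - 2 * (L w * T w)) (stdGaussian V3) := hL2.sub hLT2
    have hsplit : ∫ w, (L w - T w) ^ 2 ∂stdGaussian V3 = ∫ w, L w ^ 2 ∂stdGaussian V3 -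
        2 * ∫ w, L w * T w ∂stdGaussian V3 + ∫ w, T w ^ 2 ∂stdGaussian V3 := by
      rw [← integral_const_mul, ← integral_sub hL2 hLT2, ← integral_add hL2T hT2]
      exact integral_congr_ae (Eventually.of_forall fun w => by ring)
    rw [hsplit, hL, hT, gmw_integral_likelihoodRatio_sq hr hr2 a, gmw_integral_likelihoodRatio_mul_taylorPoly hr a,
      gmw_integral_taylorPoly_sq a r]
  -- the elementary bound and the conclusion
  have h7 := c9_gaussian_remainder_le_sq_entropy (sq_nonneg ‖a‖) ht hu
  have hD0 : 0 ≤ (‖a‖ ^ 2 + 3 * (r - 1 - Real.log r)) / 2 := by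
    have := Real.log_le_sub_one_of_pos hr
    positivity
  have hI0 : 0 ≤ ∫ w, |L w - T w| ∂stdGaussian V3 := integral_nonneg fun w => abs_nonneg _
  have h8 : ∫ w, |L w - T w| ∂stdGaussian V3 ≤ 5 * ((‖a‖ ^ 2 + 3 * (r - 1 - Real.log r)) / 2) := by
    refine (pow_le_pow_iff_left₀ hI0 (by positivity) two_ne_zero).1 ?_
    rw [mul_pow]
    norm_num
    linarith
  linarith

/-! ## The Gaussian second-order lemma -/

/-- **THE GAUSSIAN SECOND-ORDER LEMMA** (piece (P2) of the Gibbs-mixture wall). There is a universal `C > 0` such that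
for every continuous `g : ℝ³ → ℝ` with `|g| ≤ 1` and `g ⊥ 1, v, |v|²` in `L²(N(0, I))`, every drift `a` and every
variance `r > 0`: `|E_{N(a, rI)} g| ≤ C · KL(N(a, rI) ‖ N(0, I)) = C (|a|² + 3(r - 1 - log r))/2`. Near `(0, 1)` this is
`gmw_abs_integral_affine_le_near` (orthogonality kills the zeroth and first order); far from it the entropy is bounded below
(`gmw_sub_one_sub_log_ge_of_far`) while `|E g| ≤ 1`. -/
theorem c9_gaussian_orthogonal_mean_le_kl : ∃ C : ℝ, 0 < C ∧
    ∀ (g : V3 → ℝ), Continuous g → (∀ v, |g v| ≤ 1) →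
    (∀ (c₀ c₂ : ℝ) (b : V3), ∫ v, g v * (c₀ + inner ℝ b v + c₂ * ‖v‖ ^ 2) ∂(stdGaussian V3) = 0) →
    ∀ (a : V3) (r : ℝ), 0 < r →
      |∫ w, g (a + Real.sqrt r • w) ∂(stdGaussian V3)| ≤ C * ((‖a‖ ^ 2 + 3 * (r - 1 - Real.log r)) / 2) := by
  refine ⟨400 / 3, by norm_num, fun g hg hg1 horth a r hr => ?_⟩
  have hlog0 : 0 ≤ r - 1 - Real.log r := by linarith [Real.log_le_sub_one_of_pos hr]
  by_cases hnear : ‖a‖ ^ 2 ≤ 1 / 8 ∧ |r - 1| ≤ 1 / 8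
  · have h := gmw_abs_integral_affine_le_near hg hg1 horth hr hnear.1 hnear.2
    nlinarith [h, sq_nonneg ‖a‖]
  · have h1 : |∫ w, g (a + Real.sqrt r • w) ∂stdGaussian V3| ≤ 1 := by
      rw [← Real.norm_eq_abs]
      refine (norm_integral_le_of_norm_le (integrable_const (1 : ℝ)) (ae_of_all _ fun w => ?_)).trans ?_
      · rw [Real.norm_eq_abs]
        exact hg1 _
      · simp
    have hD : 3 / 400 ≤ (‖a‖ ^ 2 + 3 * (r - 1 - Real.log r)) / 2 := by
      rcases not_and_or.1 hnear with h | h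
      · have h' := not_le.1 h
        linarith [sq_nonneg ‖a‖]
      · have h' := gmw_sub_one_sub_log_ge_of_far hr (not_le.1 h).le
        linarith [sq_nonneg ‖a‖]
    linarith

/-- The Gaussian second-order lemma for test functions bounded by `K ≥ 0`: `|E_{N(a,rI)} g| ≤ C K · KL(N(a,rI) ‖ N(0,I))`
(scaling of `c9_gaussian_orthogonal_mean_le_kl`). -/
theorem c9_gaussian_orthogonal_mean_le_kl_of_bound : ∃ C : ℝ, 0 < C ∧
    ∀ (K : ℝ), 0 ≤ K → ∀ (g : V3 → ℝ), Continuous g → (∀ v, |g v| ≤ K) →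
    (∀ (c₀ c₂ : ℝ) (b : V3), ∫ v, g v * (c₀ + inner ℝ b v + c₂ * ‖v‖ ^ 2) ∂(stdGaussian V3) = 0) →
    ∀ (a : V3) (r : ℝ), 0 < r →
      |∫ w, g (a + Real.sqrt r • w) ∂(stdGaussian V3)| ≤ C * K * ((‖a‖ ^ 2 + 3 * (r - 1 - Real.log r)) / 2) := by
  obtain ⟨C, hC, h⟩ := c9_gaussian_orthogonal_mean_le_kl
  refine ⟨C, hC, fun K hK g hg hgK horth a r hr => ?_⟩
  rcases hK.eq_or_lt with hK0 | hK0
  · have hg0 : ∀ v, g v = 0 := fun v => abs_nonpos_iff.1 (hK0 ▸ hgK v)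
    subst hK0
    simp [hg0]
  · have h1 := h (fun v => K⁻¹ * g v) (by fun_prop) (fun v => by
      rw [abs_mul, abs_inv, abs_of_pos hK0, inv_mul_le_iff₀ hK0, mul_one]; exact hgK v) (fun c₀ c₂ b => by
      simp_rw [mul_assoc]; rw [integral_const_mul, horth, mul_zero]) a r hr
    rw [integral_const_mul, abs_mul, abs_inv, abs_of_pos hK0, inv_mul_le_iff₀ hK0] at h1
    linarith

end Summit.AtomisticToContinuum.HydrodynamicLimit.Theorems.KiferCompactification

end
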